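import Mathlib.Analysis.Complex.Basic
import Mathlib.GroupTheory.Perm.Fin
import Literature.RepresentationTheory.FiniteGroups.AldousLambdaOne
import HarnessLib

/-!
# The `ℓ²` Dirichlet form of a transposition on `ℂ[𝔖ₙ]` (toolkit for the interchange process)

Topic `Literature/RepresentationTheory/FiniteGroups`. Elementary `ℓ²` bookkeeping on functions
`Equiv.Perm (Fin n) → ℂ` (the carrier of the left regular representation `permLeftRegular n` of
`AldousLambdaOne.lean`), used by the proof of the octopus inequality and of the
Caputo–Liggett–Richthammer theorem (`OctopusInequality.lean`, `InterchangeSpectralGap.lean`):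

* `l2Inner f g = ∑_τ conj (f τ) g τ`, `l2NormSq f = ∑_τ ‖f τ‖²` and their algebra
  (`l2NormSq_sub`, the polarisation bound `two_mul_re_l2Inner_ge`);
* invariance of both under the left shifts `f ↦ f (g * ·)` and the adjoint relation
  `l2Inner_shift_right` (`λ(g)* = λ(g⁻¹)`);
* `transpDirichlet u v f = ∑_τ ‖f (swap u v * τ) - f τ‖² = ν[(∇_{uv} f)²] · n!` (CLR §2.2, the
  gradient `∇_{xy} f(η) = f(η^{xy}) − f(η)`; here in the left-regular convention of the tree), with
  `transpDirichlet_eq` (`= 2‖f‖² − 2 Re⟪f, λ((uv)) f⟫`) and the bridge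
  `re_l2Inner_interchangeLaplacian` :
  `Re⟪f, L_A f⟫ = ½ ∑_{x<y} a_{xy} ∑_τ ‖f((xy)τ) − f(τ)‖²` (CLR §2.3, `𝓔(f) = ½ ∑_b c_b ν[(∇_b f)²]`);
* averaging over the symmetric group: `sum_perm_apply_eq` (`∑_τ F(τ i) = (n−1)! ∑_x F x`) and
  `sum_perm_apply_apply_eq` (`∑_τ F(τ i, τ j) = (n−2)! ∑_{x ≠ y} F(x, y)` for `i ≠ j`);
* the block bijection `blockEmb p e = ext e * swap 0 p : Fin (m+1) × Perm (Fin m) ≃ Perm (Fin (m+1))`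
  (`ext e = Equiv.Perm.decomposeFin.symm (0, e)`), whose blocks `{τ | τ p = 0}` are the cosets used in
  CLR §2.4 ("for a fixed value of `η_x`, `ν[· | η_x]` is the uniform measure on the permutations of
  `V ∖ {x}`"): `sum_blockEmb`, `swap_succ_mul_blockEmb`.

## References

* P. Caputo, T. M. Liggett, T. Richthammer, *Proof of Aldous' spectral gap conjecture*, J. Amer.
  Math. Soc. 23 (2010) 831–851, arXiv:0906.1238: §1.1 (Dirichlet form and gap), §2.2–2.4.
  [CaputoLiggettRichthammer2010]

## Mathlib and tree

Mathlib: `Equiv.Perm.decomposeFin` (`decomposeFin_symm_apply_zero/succ`), `Equiv.swap`,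
`Equiv.sum_comp`, `Fintype.sum_prod_type`, `Complex.conj_mul'`, `Fintype.card_perm`.
Tree: `permLeftRegular`, `interchangeLaplacian`, `interchangeLaplacian_apply` (`AldousLambdaOne.lean`).
-/

noncomputable section

open scoped BigOperators ComplexConjugate
open Equiv Finset

namespace Literature.RepresentationTheory.FiniteGroups

/-! ### `ℓ²` inner product and norm on functions on a finite type -/

section L2

variable {Ω : Type*} [Fintype Ω]

/-- The `ℓ²` inner product `⟪f, g⟫ = ∑_ω conj (f ω) · g ω` (linear in `g`). [folklore] -/
def l2Inner (f g : Ω → ℂ) : ℂ := ∑ ω, conj (f ω) * g ω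

/-- The squared `ℓ²` norm `‖f‖² = ∑_ω ‖f ω‖²`. [folklore] -/
def l2NormSq (f : Ω → ℂ) : ℝ := ∑ ω, ‖f ω‖ ^ 2

/-- Unfolding lemma for `l2Inner`. [folklore] -/
theorem l2Inner_def (f g : Ω → ℂ) : l2Inner f g = ∑ ω, conj (f ω) * g ω := rfl

/-- Unfolding lemma for `l2NormSq`. [folklore] -/
theorem l2NormSq_def (f : Ω → ℂ) : l2NormSq f = ∑ ω, ‖f ω‖ ^ 2 := rfl

/-- `⟪f, f⟫ = ‖f‖²`. [folklore] -/
theorem l2Inner_self (f : Ω → ℂ) : l2Inner f f = (l2NormSq f : ℂ) := by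
  simp only [l2Inner, l2NormSq, Complex.ofReal_sum, Complex.ofReal_pow]
  exact Finset.sum_congr rfl fun ω _ => Complex.conj_mul' (f ω)

/-- `Re⟪f, f⟫ = ‖f‖²`. [folklore] -/
theorem l2Inner_self_re (f : Ω → ℂ) : (l2Inner f f).re = l2NormSq f := by
  rw [l2Inner_self, Complex.ofReal_re]

/-- `‖f‖² ≥ 0`. [folklore] -/
theorem l2NormSq_nonneg (f : Ω → ℂ) : 0 ≤ l2NormSq f :=
  Finset.sum_nonneg fun ω _ => by positivity

/-- `‖f‖² = 0 ↔ f = 0`. [folklore] -/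
theorem l2NormSq_eq_zero_iff (f : Ω → ℂ) : l2NormSq f = 0 ↔ f = 0 := by
  rw [l2NormSq, Finset.sum_eq_zero_iff_of_nonneg fun ω _ => by positivity]
  simp only [Finset.mem_univ, true_implies, ne_eq, OfNat.ofNat_ne_zero, not_false_eq_true,
    pow_eq_zero_iff, norm_eq_zero]
  exact ⟨fun h => funext h, fun h ω => by rw [h]; rfl⟩

/-- `‖f‖² > 0 ↔ f ≠ 0`. [folklore] -/
theorem l2NormSq_pos_iff (f : Ω → ℂ) : 0 < l2NormSq f ↔ f ≠ 0 := by
  rw [(l2NormSq_nonneg f).lt_iff_ne, ne_comm, Ne, l2NormSq_eq_zero_iff]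

/-- `‖0‖² = 0`. [folklore] -/
@[simp] theorem l2NormSq_zero : l2NormSq (0 : Ω → ℂ) = 0 := (l2NormSq_eq_zero_iff 0).2 rfl

/-- `⟪0, g⟫ = 0`. [folklore] -/
@[simp] theorem l2Inner_zero_left (g : Ω → ℂ) : l2Inner 0 g = 0 := by simp [l2Inner]

/-- `⟪f, 0⟫ = 0`. [folklore] -/
@[simp] theorem l2Inner_zero_right (f : Ω → ℂ) : l2Inner f 0 = 0 := by simp [l2Inner]

/-- Additivity of `⟪·, g⟫`. [folklore] -/
theorem l2Inner_add_left (f₁ f₂ g : Ω → ℂ) :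
    l2Inner (f₁ + f₂) g = l2Inner f₁ g + l2Inner f₂ g := by
  simp only [l2Inner, Pi.add_apply, map_add, add_mul, Finset.sum_add_distrib]

/-- Additivity of `⟪f, ·⟫`. [folklore] -/
theorem l2Inner_add_right (f g₁ g₂ : Ω → ℂ) :
    l2Inner f (g₁ + g₂) = l2Inner f g₁ + l2Inner f g₂ := by
  simp only [l2Inner, Pi.add_apply, mul_add, Finset.sum_add_distrib]

/-- `⟪f₁ − f₂, g⟫ = ⟪f₁, g⟫ − ⟪f₂, g⟫`. [folklore] -/
theorem l2Inner_sub_left (f₁ f₂ g : Ω → ℂ) :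
    l2Inner (f₁ - f₂) g = l2Inner f₁ g - l2Inner f₂ g := by
  simp only [l2Inner, Pi.sub_apply, map_sub, sub_mul, Finset.sum_sub_distrib]

/-- `⟪f, g₁ − g₂⟫ = ⟪f, g₁⟫ − ⟪f, g₂⟫`. [folklore] -/
theorem l2Inner_sub_right (f g₁ g₂ : Ω → ℂ) :
    l2Inner f (g₁ - g₂) = l2Inner f g₁ - l2Inner f g₂ := by
  simp only [l2Inner, Pi.sub_apply, mul_sub, Finset.sum_sub_distrib]

/-- `⟪−f, g⟫ = −⟪f, g⟫`. [folklore] -/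
theorem l2Inner_neg_left (f g : Ω → ℂ) : l2Inner (-f) g = -l2Inner f g := by
  simp only [l2Inner, Pi.neg_apply, map_neg, neg_mul, Finset.sum_neg_distrib]

/-- `⟪f, −g⟫ = −⟪f, g⟫`. [folklore] -/
theorem l2Inner_neg_right (f g : Ω → ℂ) : l2Inner f (-g) = -l2Inner f g := by
  simp only [l2Inner, Pi.neg_apply, mul_neg, Finset.sum_neg_distrib]

/-- Conjugate-linearity in the first slot. [folklore] -/
theorem l2Inner_smul_left (c : ℂ) (f g : Ω → ℂ) : l2Inner (c • f) g = conj c * l2Inner f g := by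
  simp only [l2Inner, Pi.smul_apply, smul_eq_mul, map_mul, Finset.mul_sum, mul_assoc]

/-- Linearity in the second slot. [folklore] -/
theorem l2Inner_smul_right (c : ℂ) (f g : Ω → ℂ) : l2Inner f (c • g) = c * l2Inner f g := by
  simp only [l2Inner, Pi.smul_apply, smul_eq_mul, Finset.mul_sum]
  exact Finset.sum_congr rfl fun ω _ => by ring

/-- `⟪f, ∑ gᵢ⟫ = ∑ ⟪f, gᵢ⟫`. [folklore] -/
theorem l2Inner_sum_right {ι : Type*} (s : Finset ι) (f : Ω → ℂ) (g : ι → Ω → ℂ) :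
    l2Inner f (∑ i ∈ s, g i) = ∑ i ∈ s, l2Inner f (g i) := by
  simp only [l2Inner, Finset.sum_apply, Finset.mul_sum]
  rw [Finset.sum_comm]

/-- `⟪∑ fᵢ, g⟫ = ∑ ⟪fᵢ, g⟫`. [folklore] -/
theorem l2Inner_sum_left {ι : Type*} (s : Finset ι) (f : ι → Ω → ℂ) (g : Ω → ℂ) :
    l2Inner (∑ i ∈ s, f i) g = ∑ i ∈ s, l2Inner (f i) g := by
  simp only [l2Inner, Finset.sum_apply, map_sum, Finset.sum_mul]
  rw [Finset.sum_comm]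

/-- Hermitian symmetry `conj ⟪f, g⟫ = ⟪g, f⟫`. [folklore] -/
theorem conj_l2Inner (f g : Ω → ℂ) : conj (l2Inner f g) = l2Inner g f := by
  simp only [l2Inner, map_sum, map_mul, RingHomCompTriple.comp_apply, RingHom.id_apply]
  exact Finset.sum_congr rfl fun ω _ => mul_comm _ _

/-- `Re⟪f, g⟫ = Re⟪g, f⟫`. [folklore] -/
theorem l2Inner_re_symm (f g : Ω → ℂ) : (l2Inner f g).re = (l2Inner g f).re := by
  rw [← conj_l2Inner f g, Complex.conj_re]

/-- `‖−f‖² = ‖f‖²`. [folklore] -/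
theorem l2NormSq_neg (f : Ω → ℂ) : l2NormSq (-f) = l2NormSq f := by
  simp only [l2NormSq, Pi.neg_apply, norm_neg]

/-- `‖c f‖² = |c|² ‖f‖²`. [folklore] -/
theorem l2NormSq_smul (c : ℂ) (f : Ω → ℂ) : l2NormSq (c • f) = ‖c‖ ^ 2 * l2NormSq f := by
  simp only [l2NormSq, Pi.smul_apply, smul_eq_mul, norm_mul, mul_pow, Finset.mul_sum]

/-- `‖f + g‖² = ‖f‖² + ‖g‖² + 2 Re⟪f, g⟫`. [folklore] -/
theorem l2NormSq_add (f g : Ω → ℂ) :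
    l2NormSq (f + g) = l2NormSq f + l2NormSq g + 2 * (l2Inner f g).re := by
  have h : (l2NormSq (f + g) : ℂ) = l2NormSq f + l2NormSq g + l2Inner f g + l2Inner g f := by
    rw [← l2Inner_self, ← l2Inner_self, ← l2Inner_self, l2Inner_add_left, l2Inner_add_right,
      l2Inner_add_right]
    ring
  apply_fun Complex.re at h
  rw [Complex.ofReal_re] at h
  rw [h]
  simp only [Complex.add_re, Complex.ofReal_re, l2Inner_re_symm g f]
  ring

/-- `‖f − g‖² = ‖f‖² + ‖g‖² − 2 Re⟪f, g⟫`. [folklore] -/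
theorem l2NormSq_sub (f g : Ω → ℂ) :
    l2NormSq (f - g) = l2NormSq f + l2NormSq g - 2 * (l2Inner f g).re := by
  rw [sub_eq_add_neg, l2NormSq_add, l2NormSq_neg, l2Inner_neg_right, Complex.neg_re]
  ring

/-- **Polarisation bound**: `2 Re⟪f, g⟫ ≥ −(t‖f‖² + ‖g‖²/t)` for `t > 0` (from
`0 ≤ ‖t f + g‖²`); the substitute for Cauchy–Schwarz used in CLR §3.1 ("`C̃ = AᵗA ≥ 0`").
[folklore] -/
theorem two_mul_re_l2Inner_ge (f g : Ω → ℂ) {t : ℝ} (ht : 0 < t) :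
    -(t * l2NormSq f + l2NormSq g / t) ≤ 2 * (l2Inner f g).re := by
  have h := l2NormSq_nonneg ((t : ℂ) • f + g)
  rw [l2NormSq_add, l2NormSq_smul, l2Inner_smul_left, Complex.conj_ofReal, Complex.norm_real,
    Real.norm_eq_abs, abs_of_pos ht, Complex.re_ofReal_mul] at h
  -- `0 ≤ t² ‖f‖² + ‖g‖² + 2 t Re⟪f,g⟫`; divide by `t`
  have h' : 0 ≤ t * (t * l2NormSq f + l2NormSq g / t + 2 * (l2Inner f g).re) := by
    have : t * (t * l2NormSq f + l2NormSq g / t + 2 * (l2Inner f g).re) =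
        t ^ 2 * l2NormSq f + l2NormSq g + 2 * (t * (l2Inner f g).re) := by
      field_simp
    rw [this]
    exact h
  have := nonneg_of_mul_nonneg_right (by rwa [mul_comm] at h') ht
  linarith

end L2

/-! ### Left shifts by group elements -/

section Shift

variable {G : Type*} [Group G] [Fintype G]

/-- `‖f(g ·)‖² = ‖f‖²` (left shifts are bijections). [folklore] -/
theorem l2NormSq_shift (f : G → ℂ) (g : G) : l2NormSq (fun τ => f (g * τ)) = l2NormSq f :=
  Fintype.sum_equiv (Equiv.mulLeft g) _ _ fun _ => rfl

/-- `⟪f(g ·), h(g ·)⟫ = ⟪f, h⟫`. [folklore] -/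
theorem l2Inner_shift (f h : G → ℂ) (g : G) :
    l2Inner (fun τ => f (g * τ)) (fun τ => h (g * τ)) = l2Inner f h :=
  Fintype.sum_equiv (Equiv.mulLeft g) _ _ fun _ => rfl

/-- **`λ(g)* = λ(g⁻¹)`**: `⟪f, h(g ·)⟫ = ⟪f(g⁻¹ ·), h⟫`. [folklore] -/
theorem l2Inner_shift_right (f h : G → ℂ) (g : G) :
    l2Inner f (fun τ => h (g * τ)) = l2Inner (fun τ => f (g⁻¹ * τ)) h := by
  rw [← l2Inner_shift (fun τ => f (g⁻¹ * τ)) h g]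
  simp only [inv_mul_cancel_left]

/-- For an involution `s` (e.g. a transposition), `⟪f, h(s ·)⟫ = ⟪f(s ·), h⟫`. [folklore] -/
theorem l2Inner_shift_right_of_mul_self (f h : G → ℂ) {s : G} (hs : s * s = 1) :
    l2Inner f (fun τ => h (s * τ)) = l2Inner (fun τ => f (s * τ)) h := by
  rw [l2Inner_shift_right, ← mul_eq_one_iff_eq_inv.mp hs]

/-- Hence `Re⟪f, f(s ·)⟫` is symmetric: `⟪f, f(s·)⟫` is real for an involution `s`; more
generally `⟪f, h(s ·)⟫` and `⟪h, f(s ·)⟫` are complex conjugate. [folklore] -/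
theorem conj_l2Inner_shift_of_mul_self (f h : G → ℂ) {s : G} (hs : s * s = 1) :
    conj (l2Inner f (fun τ => h (s * τ))) = l2Inner h (fun τ => f (s * τ)) := by
  rw [conj_l2Inner, l2Inner_shift_right_of_mul_self h f hs]

end Shift

/-! ### Averaging over the symmetric group -/

section PermSums

variable {α : Type*} [Fintype α] [DecidableEq α] {M : Type*} [AddCommMonoid M]

/-- The number of permutations with a prescribed value at one point does not depend on the
point or the value. [folklore] -/
theorem card_perm_apply_eq (i x : α) :
    (Finset.univ.filter fun τ : Perm α => τ i = x).card =
      (Finset.univ.filter fun τ : Perm α => τ i = i).card := by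
  refine Finset.card_bij (fun τ _ => swap i x * τ) (fun τ hτ => ?_) (fun τ₁ _ τ₂ _ h => ?_)
    (fun τ hτ => ?_)
  · simp only [Finset.mem_filter, Finset.mem_univ, true_and] at hτ ⊢
    rw [Perm.mul_apply, hτ, swap_apply_right]
  · exact mul_left_cancel h
  · refine ⟨swap i x * τ, ?_, ?_⟩
    · simp only [Finset.mem_filter, Finset.mem_univ, true_and] at hτ ⊢
      rw [Perm.mul_apply, hτ, swap_apply_left]
    · rw [← mul_assoc, swap_mul_self, one_mul]

/-- `#{τ | τ i = x} = (|α| − 1)!`. [folklore] -/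
theorem card_perm_apply_eq_factorial (i x : α) :
    (Finset.univ.filter fun τ : Perm α => τ i = x).card = (Fintype.card α - 1).factorial := by
  classical
  have hsum : ∑ y : α, (Finset.univ.filter fun τ : Perm α => τ i = y).card =
      Fintype.card (Perm α) := by
    rw [← Finset.card_univ, ← Finset.card_biUnion]
    · congr 1
      ext τ
      simp only [Finset.mem_biUnion, Finset.mem_univ, Finset.mem_filter, true_and, exists_eq']
    · intro y _ y' _ hne
      simp only [Function.onFun]
      rw [Finset.disjoint_filter]
      intro τ _ h h'
      exact hne (h.symm.trans h')
  simp_rw [card_perm_apply_eq i, Finset.sum_const, Finset.card_univ, smul_eq_mul,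
    Fintype.card_perm] at hsum
  rw [card_perm_apply_eq i x]
  have hpos : 0 < Fintype.card α := Fintype.card_pos_iff.mpr ⟨i⟩
  have hfac : (Fintype.card α).factorial = Fintype.card α * (Fintype.card α - 1).factorial :=
    (Nat.mul_factorial_pred hpos.ne').symm
  rw [hfac] at hsum
  exact Nat.eq_of_mul_eq_mul_left hpos hsum

/-- **Averaging one coordinate over `𝔖_α`**: `∑_τ F(τ i) = (|α| − 1)! • ∑_x F x`. [folklore] -/
theorem sum_perm_apply_eq (F : α → M) (i : α) :
    ∑ τ : Perm α, F (τ i) = (Fintype.card α - 1).factorial • ∑ x, F x := by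
  rw [← Finset.sum_fiberwise_of_maps_to (g := fun τ : Perm α => τ i) (t := Finset.univ)
    (fun _ _ => Finset.mem_univ _), Finset.smul_sum]
  refine Finset.sum_congr rfl fun x _ => ?_
  rw [Finset.sum_congr rfl fun τ hτ => by rw [(Finset.mem_filter.mp hτ).2], Finset.sum_const,
    card_perm_apply_eq_factorial]

/-- The number of permutations with prescribed (distinct) values at two distinct points does
not depend on the points or the values. [folklore] -/
theorem card_perm_apply_apply_eq {i j x y : α} (hij : i ≠ j) (hxy : x ≠ y) :
    (Finset.univ.filter fun τ : Perm α => τ i = x ∧ τ j = y).card =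
      (Finset.univ.filter fun τ : Perm α => τ i = i ∧ τ j = j).card := by
  -- a permutation `g` with `g i = x`, `g j = y`
  set j' := swap i x j with hj'
  have hj'x : j' ≠ x := by
    rw [hj']
    intro h
    have := (swap i x).injective (h.trans (swap_apply_left i x).symm)
    exact hij this.symm
  obtain ⟨g, hgi, hgj⟩ : ∃ g : Perm α, g i = x ∧ g j = y := by
    refine ⟨swap j' y * swap i x, ?_, ?_⟩
    · rw [Perm.mul_apply, swap_apply_left, swap_apply_of_ne_of_ne hj'x.symm hxy]
    · rw [Perm.mul_apply, ← hj', swap_apply_left]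
  refine Finset.card_bij (fun τ _ => g⁻¹ * τ) (fun τ hτ => ?_) (fun τ₁ _ τ₂ _ h => ?_)
    (fun τ hτ => ?_)
  · simp only [Finset.mem_filter, Finset.mem_univ, true_and] at hτ ⊢
    rw [Perm.mul_apply, Perm.mul_apply, hτ.1, hτ.2, Perm.inv_eq_iff_eq, Perm.inv_eq_iff_eq]
    exact ⟨hgi.symm, hgj.symm⟩
  · exact mul_left_cancel h
  · refine ⟨g * τ, ?_, ?_⟩
    · simp only [Finset.mem_filter, Finset.mem_univ, true_and] at hτ ⊢
      rw [Perm.mul_apply, Perm.mul_apply, hτ.1, hτ.2]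
      exact ⟨hgi, hgj⟩
    · rw [inv_mul_cancel_left]

/-- `#{τ | τ i = x, τ j = y} = (|α| − 2)!` for `i ≠ j`, `x ≠ y`. [folklore] -/
theorem card_perm_apply_apply_eq_factorial {i j x y : α} (hij : i ≠ j) (hxy : x ≠ y) :
    (Finset.univ.filter fun τ : Perm α => τ i = x ∧ τ j = y).card =
      (Fintype.card α - 2).factorial := by
  classical
  -- sum over `y ≠ x` of the (equal) cardinalities is `#{τ | τ i = x} = (|α|-1)!`
  have hsum : ∑ y ∈ Finset.univ.filter (fun y => y ≠ x),
      (Finset.univ.filter fun τ : Perm α => τ i = x ∧ τ j = y).card =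
      (Finset.univ.filter fun τ : Perm α => τ i = x).card := by
    rw [← Finset.card_biUnion]
    · congr 1
      ext τ
      simp only [Finset.mem_biUnion, Finset.mem_filter, Finset.mem_univ, true_and]
      constructor
      · rintro ⟨y, -, h, -⟩
        exact h
      · intro h
        refine ⟨τ j, ?_, h, rfl⟩
        rw [← h]
        exact fun e => hij (τ.injective e).symm
    · intro y _ y' _ hne
      simp only [Function.onFun]
      rw [Finset.disjoint_filter]
      intro τ _ h h'
      exact hne (h.2.symm.trans h'.2)
  rw [Finset.sum_congr rfl fun y' hy' => card_perm_apply_apply_eq hij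
      (Ne.symm (Finset.mem_filter.mp hy').2), Finset.sum_const, smul_eq_mul,
    card_perm_apply_eq_factorial, Finset.filter_ne' Finset.univ x, Finset.card_erase_of_mem
      (Finset.mem_univ x), Finset.card_univ] at hsum
  rw [card_perm_apply_apply_eq hij hxy]
  have h2 : 2 ≤ Fintype.card α := by
    rw [← Finset.card_univ]
    exact Finset.one_lt_card.mpr ⟨i, Finset.mem_univ _, j, Finset.mem_univ _, hij⟩
  have hfac : (Fintype.card α - 1).factorial =
      (Fintype.card α - 1) * (Fintype.card α - 2).factorial := by
    have : Fintype.card α - 1 = (Fintype.card α - 2) + 1 := by omega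
    rw [this, Nat.factorial_succ]
  rw [hfac] at hsum
  exact Nat.eq_of_mul_eq_mul_left (by omega) hsum

/-- **Averaging two coordinates over `𝔖_α`**:
`∑_τ F(τ i, τ j) = (|α| − 2)! • ∑_x ∑_{y ≠ x} F(x, y)` for `i ≠ j`. [folklore] -/
theorem sum_perm_apply_apply_eq (F : α → α → M) {i j : α} (hij : i ≠ j) :
    ∑ τ : Perm α, F (τ i) (τ j) =
      (Fintype.card α - 2).factorial • ∑ x, ∑ y ∈ Finset.univ.filter (fun y => y ≠ x), F x y := by
  classical
  -- fibre over the pair `(τ i, τ j)`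
  have hmaps : ∀ τ ∈ (Finset.univ : Finset (Perm α)),
      (τ i, τ j) ∈ (Finset.univ : Finset (α × α)).filter fun p => p.2 ≠ p.1 := by
    intro τ _
    simp only [Finset.mem_filter, Finset.mem_univ, true_and]
    exact fun e => hij (τ.injective e).symm
  rw [← Finset.sum_fiberwise_of_maps_to hmaps]
  rw [Finset.sum_filter, ← Finset.univ_product_univ, Finset.sum_product, Finset.smul_sum]
  refine Finset.sum_congr rfl fun x _ => ?_
  rw [Finset.sum_filter, Finset.smul_sum]
  refine Finset.sum_congr rfl fun y _ => ?_
  split_ifs with hxy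
  · have : ∀ τ ∈ Finset.univ.filter (fun τ : Perm α => (τ i, τ j) = (x, y)),
        F (τ i) (τ j) = F x y := by
      intro τ hτ
      obtain ⟨h1, h2⟩ := Prod.mk.injEq _ _ _ _ ▸ (Finset.mem_filter.mp hτ).2
      rw [h1, h2]
    rw [Finset.sum_congr rfl this, Finset.sum_const]
    congr 1
    rw [← card_perm_apply_apply_eq_factorial hij (Ne.symm hxy)]
    congr 1
    ext τ
    simp only [Finset.mem_filter, Finset.mem_univ, true_and, Prod.mk.injEq]
  · exact (smul_zero _).symm

end PermSums

/-! ### The Dirichlet form of one transposition -/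

section Transp

variable {n : ℕ}

/-- **`n! · ν[(∇_{uv} f)²]`**: the Dirichlet form `∑_τ ‖f((u v) τ) − f(τ)‖²` of the single
transposition `(u v)` acting on `ℂ[𝔖ₙ]` by left shifts (CLR §2.2: `∇_{xy} f(η) = f(η^{xy}) − f(η)`;
the tree's left-regular convention). [cite: CaputoLiggettRichthammer2010, §2.2] -/
def transpDirichlet (u v : Fin n) (f : Perm (Fin n) → ℂ) : ℝ :=
  ∑ τ, ‖f (swap u v * τ) - f τ‖ ^ 2

/-- Unfolding lemma for `transpDirichlet`. [folklore] -/
theorem transpDirichlet_def (u v : Fin n) (f : Perm (Fin n) → ℂ) :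
    transpDirichlet u v f = ∑ τ, ‖f (swap u v * τ) - f τ‖ ^ 2 := rfl

/-- `transpDirichlet u v f = ‖f((uv)·) − f‖²`. [folklore] -/
theorem transpDirichlet_eq_l2NormSq (u v : Fin n) (f : Perm (Fin n) → ℂ) :
    transpDirichlet u v f = l2NormSq ((fun τ => f (swap u v * τ)) - f) := rfl

/-- A Dirichlet form is non-negative. [folklore] -/
theorem transpDirichlet_nonneg (u v : Fin n) (f : Perm (Fin n) → ℂ) : 0 ≤ transpDirichlet u v f :=
  l2NormSq_nonneg _

/-- Symmetry in the two vertices. [folklore] -/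
theorem transpDirichlet_comm (u v : Fin n) (f : Perm (Fin n) → ℂ) :
    transpDirichlet u v f = transpDirichlet v u f := by
  rw [transpDirichlet, transpDirichlet, swap_comm]

/-- The degenerate transposition `(u u) = 1` has zero Dirichlet form. [folklore] -/
@[simp] theorem transpDirichlet_self (u : Fin n) (f : Perm (Fin n) → ℂ) :
    transpDirichlet u u f = 0 := by
  simp [transpDirichlet, swap_self, Perm.one_def.symm]

/-- Adding a constant does not change a Dirichlet form. [folklore] -/
theorem transpDirichlet_add_const (u v : Fin n) (f : Perm (Fin n) → ℂ) (c : ℂ) :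
    transpDirichlet u v (fun τ => f τ + c) = transpDirichlet u v f := by
  simp only [transpDirichlet, add_sub_add_right_eq_sub]

/-- Subtracting a constant does not change a Dirichlet form. [folklore] -/
theorem transpDirichlet_sub_const (u v : Fin n) (f : Perm (Fin n) → ℂ) (c : ℂ) :
    transpDirichlet u v (fun τ => f τ - c) = transpDirichlet u v f := by
  simp only [sub_eq_add_neg, transpDirichlet_add_const]

/-- **`∑_τ ‖f((uv)τ) − f(τ)‖² = 2‖f‖² − 2 Re⟪f, f((uv)·)⟫`** (CLR §3, the step from (octopus) to
(octopus2): "`ν[(∇_b f)²] = 2ν[f²] − 2ν[f · f∘τ_b]`"). [cite: CaputoLiggettRichthammer2010, §3] -/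
theorem transpDirichlet_eq (u v : Fin n) (f : Perm (Fin n) → ℂ) :
    transpDirichlet u v f =
      2 * l2NormSq f - 2 * (l2Inner f (fun τ => f (swap u v * τ))).re := by
  rw [transpDirichlet_eq_l2NormSq, l2NormSq_sub, l2NormSq_shift,
    l2Inner_re_symm (fun τ => f (swap u v * τ)) f]
  ring

/-- `Re⟪f, f − f((uv)·)⟫ = ½ ∑_τ ‖f((uv)τ) − f(τ)‖²`. [cite: CaputoLiggettRichthammer2010, §1.1] -/
theorem re_l2Inner_sub_shift (u v : Fin n) (f : Perm (Fin n) → ℂ) :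
    (l2Inner f (f - fun τ => f (swap u v * τ))).re = transpDirichlet u v f / 2 := by
  rw [l2Inner_sub_right, Complex.sub_re, l2Inner_self_re, transpDirichlet_eq]
  ring

/-- `⟪f, L_A f⟫ = ∑_{x<y} a_{xy} ⟪f, f − f((xy)·)⟫` for the interchange Laplacian of
`AldousLambdaOne.lean`. [cite: CaputoLiggettRichthammer2010, §2.3] -/
theorem l2Inner_interchangeLaplacian (A : Fin n → Fin n → ℝ) (f : Perm (Fin n) → ℂ) :
    l2Inner f (interchangeLaplacian n A f) =
      ∑ x : Fin n, ∑ y : Fin n with x < y,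
        ((A x y : ℝ) : ℂ) * l2Inner f (f - fun τ => f (swap x y * τ)) := by
  unfold l2Inner
  simp_rw [interchangeLaplacian_apply, Finset.mul_sum]
  rw [Finset.sum_comm]
  refine Finset.sum_congr rfl fun x _ => ?_
  rw [Finset.sum_comm]
  refine Finset.sum_congr rfl fun y _ => Finset.sum_congr rfl fun τ _ => ?_
  simp only [Pi.sub_apply]
  ring

/-- **The Dirichlet form of the interchange process**:
`Re⟪f, L_A f⟫ = ½ ∑_{x<y} a_{xy} ∑_τ ‖f((xy)τ) − f(τ)‖²`
(CLR §2.3: "`−ν[f 𝓛 f] = 𝓔(f) = ½ ∑_b c_b ν[(∇_b f)²]`").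
[cite: CaputoLiggettRichthammer2010, §2.3] -/
theorem re_l2Inner_interchangeLaplacian (A : Fin n → Fin n → ℝ) (f : Perm (Fin n) → ℂ) :
    (l2Inner f (interchangeLaplacian n A f)).re =
      ∑ x : Fin n, ∑ y : Fin n with x < y, A x y * (transpDirichlet x y f / 2) := by
  rw [l2Inner_interchangeLaplacian, Complex.re_sum]
  refine Finset.sum_congr rfl fun x _ => ?_
  rw [Complex.re_sum]
  refine Finset.sum_congr rfl fun y _ => ?_
  rw [Complex.re_ofReal_mul, re_l2Inner_sub_shift]

/-- The tree's Rayleigh quotient in these terms. [cite: CaputoLiggettRichthammer2010, §2.3] -/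
theorem rayleighQuotient_eq (A : Fin n → Fin n → ℝ) (f : Perm (Fin n) → ℂ) :
    rayleighQuotient n A f =
      (∑ x : Fin n, ∑ y : Fin n with x < y, A x y * (transpDirichlet x y f / 2)) / l2NormSq f := by
  rw [rayleighQuotient, ← re_l2Inner_interchangeLaplacian]
  rfl

end Transp

/-! ### Blocks: permutations of `Fin (m+1)` sending `p` to `0` -/

section Blocks

variable {m : ℕ}

/-- Extension of a permutation of `Fin m` to `Fin (m+1)` fixing `0` and acting on successors
(`Equiv.Perm.decomposeFin.symm (0, e)`). [folklore] -/
def permExt (e : Perm (Fin m)) : Perm (Fin (m + 1)) := Perm.decomposeFin.symm (0, e)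

/-- `ext e` fixes `0`. [folklore] -/
@[simp] theorem permExt_apply_zero (e : Perm (Fin m)) : permExt e 0 = 0 := by
  rw [permExt, Perm.decomposeFin_symm_apply_zero]

/-- `ext e` acts on successors through `e`. [folklore] -/
@[simp] theorem permExt_apply_succ (e : Perm (Fin m)) (x : Fin m) :
    permExt e x.succ = (e x).succ := by
  rw [permExt, Perm.decomposeFin_symm_apply_succ, swap_self, Equiv.refl_apply]

/-- `ext` is multiplicative. [folklore] -/
theorem permExt_mul (e₁ e₂ : Perm (Fin m)) : permExt (e₁ * e₂) = permExt e₁ * permExt e₂ := by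
  ext x
  refine Fin.cases ?_ (fun y => ?_) x
  · simp
  · simp

/-- `ext 1 = 1`. [folklore] -/
@[simp] theorem permExt_one : permExt (1 : Perm (Fin m)) = 1 := by
  ext x
  refine Fin.cases ?_ (fun y => ?_) x
  · simp
  · simp

/-- `ext` commutes with inverses. [folklore] -/
theorem permExt_inv (e : Perm (Fin m)) : permExt e⁻¹ = (permExt e)⁻¹ := by
  rw [eq_inv_iff_mul_eq_one, ← permExt_mul, inv_mul_cancel, permExt_one]

/-- `ext (x y) = (x⁺ y⁺)`. [folklore] -/
theorem permExt_swap (x y : Fin m) : permExt (swap x y) = swap x.succ y.succ := by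
  ext z
  refine Fin.cases ?_ (fun w => ?_) z
  · rw [permExt_apply_zero, swap_apply_of_ne_of_ne (Fin.succ_ne_zero x).symm
      (Fin.succ_ne_zero y).symm]
  · rw [permExt_apply_succ, swap_apply_def, swap_apply_def]
    simp only [Fin.succ_inj]
    split_ifs <;> rfl

/-- `decomposeFin.symm (p, e) = (0 p) · ext e`. [folklore] -/
theorem decomposeFin_symm_eq (p : Fin (m + 1)) (e : Perm (Fin m)) :
    Perm.decomposeFin.symm (p, e) = swap 0 p * permExt e := by
  ext x
  refine Fin.cases ?_ (fun y => ?_) x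
  · rw [Perm.decomposeFin_symm_apply_zero, Perm.mul_apply, permExt_apply_zero, swap_apply_left]
  · rw [Perm.decomposeFin_symm_apply_succ, Perm.mul_apply, permExt_apply_succ]

/-- **The block embedding**: `blockEmb p e = ext e · (0 p)`, a permutation sending `p ↦ 0`; for
fixed `p` these are exactly the permutations `τ` with `τ p = 0` (the particle `p` sits at the
removed vertex `0`), and transpositions of `{1,…,m}` act on them through `𝔖_m`
(`swap_succ_mul_blockEmb`). [cite: CaputoLiggettRichthammer2010, §2.4 (proof of Prop. 2.4)] -/
def blockEmb (p : Fin (m + 1)) (e : Perm (Fin m)) : Perm (Fin (m + 1)) := permExt e * swap 0 p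

/-- Unfolding lemma for `blockEmb`. [folklore] -/
theorem blockEmb_def (p : Fin (m + 1)) (e : Perm (Fin m)) : blockEmb p e = permExt e * swap 0 p :=
  rfl

/-- `blockEmb p e` sends `p` to `0`. [folklore] -/
@[simp] theorem blockEmb_apply_self (p : Fin (m + 1)) (e : Perm (Fin m)) : blockEmb p e p = 0 := by
  rw [blockEmb, Perm.mul_apply, swap_apply_right, permExt_apply_zero]

/-- `blockEmb p e` sends only `p` to `0`. [folklore] -/
theorem blockEmb_apply_eq_zero_iff (p q : Fin (m + 1)) (e : Perm (Fin m)) :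
    blockEmb p e q = 0 ↔ q = p := by
  constructor
  · intro h
    rw [← blockEmb_apply_self p e] at h
    exact (blockEmb p e).injective h
  · rintro rfl
    exact blockEmb_apply_self q e

/-- Transpositions of positive vertices act inside the blocks:
`(x⁺ y⁺) · blockEmb p e = blockEmb p ((x y) · e)`. [cite: CaputoLiggettRichthammer2010, §2.4] -/
theorem swap_succ_mul_blockEmb (x y : Fin m) (p : Fin (m + 1)) (e : Perm (Fin m)) :
    swap x.succ y.succ * blockEmb p e = blockEmb p (swap x y * e) := by
  rw [blockEmb, blockEmb, permExt_mul, permExt_swap, mul_assoc]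

/-- **Summing over `𝔖_{m+1}` block by block**: `∑_τ F(τ) = ∑_p ∑_{e ∈ 𝔖_m} F(blockEmb p e)`.
[cite: CaputoLiggettRichthammer2010, §2.4] -/
theorem sum_blockEmb {M : Type*} [AddCommMonoid M] (F : Perm (Fin (m + 1)) → M) :
    ∑ τ, F τ = ∑ p : Fin (m + 1), ∑ e : Perm (Fin m), F (blockEmb p e) := by
  calc ∑ τ, F τ = ∑ τ : Perm (Fin (m + 1)), F τ⁻¹ :=
        (Fintype.sum_equiv (Equiv.inv (Perm (Fin (m + 1)))) _ _ fun τ => by simp).symm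
    _ = ∑ pe : Fin (m + 1) × Perm (Fin m), F (Perm.decomposeFin.symm pe)⁻¹ :=
        (Equiv.sum_comp Perm.decomposeFin.symm (fun τ => F τ⁻¹)).symm
    _ = ∑ p : Fin (m + 1), ∑ e : Perm (Fin m), F (permExt e⁻¹ * swap 0 p) := by
        rw [Fintype.sum_prod_type]
        refine Finset.sum_congr rfl fun p _ => Finset.sum_congr rfl fun e _ => ?_
        rw [decomposeFin_symm_eq, mul_inv_rev, swap_inv, permExt_inv]
    _ = ∑ p : Fin (m + 1), ∑ e : Perm (Fin m), F (blockEmb p e) := by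
        refine Finset.sum_congr rfl fun p _ => ?_
        exact Fintype.sum_equiv (Equiv.inv (Perm (Fin m))) _ _ fun e => by simp [blockEmb]

/-- The block of `p` is `{τ | τ p = 0}`: `∑_{τ : τ p = 0} F(τ) = ∑_{e ∈ 𝔖_m} F(blockEmb p e)`.
[cite: CaputoLiggettRichthammer2010, §2.4] -/
theorem sum_filter_apply_eq_zero {M : Type*} [AddCommMonoid M] (F : Perm (Fin (m + 1)) → M)
    (p : Fin (m + 1)) :
    ∑ τ : Perm (Fin (m + 1)) with τ p = 0, F τ = ∑ e : Perm (Fin m), F (blockEmb p e) := by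
  rw [Finset.sum_filter, sum_blockEmb]
  simp only [blockEmb_apply_eq_zero_iff]
  rw [Finset.sum_eq_single p]
  · simp
  · intro q _ hq
    simp [Ne.symm hq]
  · exact fun h => absurd (Finset.mem_univ p) h

/-- `‖f‖² = ∑_p ‖f ∘ blockEmb p‖²`. [folklore] -/
theorem l2NormSq_eq_sum_blocks (f : Perm (Fin (m + 1)) → ℂ) :
    l2NormSq f = ∑ p : Fin (m + 1), l2NormSq (fun e => f (blockEmb p e)) :=
  sum_blockEmb _

/-- `∑_τ ‖f((x⁺y⁺)τ) − f(τ)‖² = ∑_p ∑_e ‖f_p((xy)e) − f_p(e)‖²` with `f_p = f ∘ blockEmb p`.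
[cite: CaputoLiggettRichthammer2010, §2.4] -/
theorem transpDirichlet_succ_succ (x y : Fin m) (f : Perm (Fin (m + 1)) → ℂ) :
    transpDirichlet x.succ y.succ f =
      ∑ p : Fin (m + 1), transpDirichlet x y (fun e => f (blockEmb p e)) := by
  rw [transpDirichlet, sum_blockEmb]
  refine Finset.sum_congr rfl fun p _ => ?_
  simp only [transpDirichlet, swap_succ_mul_blockEmb]

end Blocks

end Literature.RepresentationTheory.FiniteGroups

end
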